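import Literature.NumberTheory.Automorphic.StandardLTheoryGL2OfArchTestVectorAndEulerFactorisation
import HarnessLib

/-!
# The standard `L`-theory of `GL₂` from the archimedean test vector and the Euler factorisation of the
# global Hecke integral — variant `(E′)` with the archimedean absolute convergence made a hypothesis
# (Jacquet–Langlands (1970), proof of Thm. 11.1, pp. 171–173)

Topic `NumberTheory/Automorphic`; namespace `Literature.NumberTheory.Automorphic`. Theorems only (no
definition, no named fact, no instance). This is the assembly of
`StandardLTheoryGL2OfArchTestVectorAndEulerFactorisation` VERBATIM, with one change in the displayed input
`(E)` (the Euler factorisation with functional equation of the global Hecke integral of pure tensors,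
hypothesis `hE`): the conclusion `∃ Z Z' c, …` for the local vectors `(t_u)_{u ∈ S}` and the `K_∞`-finite
Gårding vector `e₀` is only required UNDER THE HYPOTHESIS that the two archimedean Hecke integrands
`u ↦ W_{e₀}(diag(u,1)) N(u)^{s-1/2}` and `u ↦ W̃_{e₀}(diag(u,1)) N(u)^{s-1/2}` are `μ_∞`-integrable on some
right half-plane `re s > x₁` — which is exactly how Jacquet–Langlands use `(E)` on p. 172 ("the integral
… is absolutely convergent … for `Re s` sufficiently large", applied to the test vector of Thm. 5.15 /
Thm. 6.4 whose archimedean integrals converge absolutely), and which is part of what the archimedean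
input `(A∞)` (hypothesis `hA`, the named fact `JacquetLanglands1970_archHeckeTestVectorGL2`) PROVIDES for
its test vector `e₀` (`Integrable … ∧ ∫ … = A e^{αs} ∏ Γ_ℝ ∏ Γ_ℂ`). The weaker input `(E′)` is the form
in which the Euler factorisation is proved in the tree from the restricted tensor product decomposition
(`HeckeIntegralPureTensorEuler`, `HeckeIntegralPureTensorDualEuler`: the absolute convergence of the
global idelic integral is deduced from that of its local factors).

* `integralRepresentation_clean_of_archHeckeTestVector_of_heckeEulerFactorisation''` — the package
  `(IR)` for clean `A_G`-invariant cuspidal data from `(A∞)` and `(E′)` (same proof as the unprimed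
  theorem, feeding the integrability clauses of `(A∞)` into `(E′)`);
* `JacquetLanglands1970_standardLTheoryGL2_of_archHeckeTestVector_of_heckeEulerFactorisation''`;
* `frobSatakeCompatibleAt_of_isPiOfArtinRep_of_isUnramifiedAt_of_archHeckeTestVector_of_heckeEulerFactorisation''`.

## References

* H. Jacquet, R. P. Langlands, *Automorphic Forms on GL(2)*, LNM 114 (1970): Thm. 5.15, Thm. 6.4,
  (11.1.2) (p. 171), Lemma 11.1.3 (p. 172), proof of Thm. 11.1 (pp. 171–173). [JacquetLanglands1970]
* S. Gelbart, *Three lectures on the modularity of `ρ̄_{E,3}` and the Langlands reciprocity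
  conjecture* (1997), Lecture II. [Gelbart1997]
-/

noncomputable section

open MeasureTheory Measure NumberField NumberField.mixedEmbedding IsDedekindDomain Polynomial
open scoped MatrixGroups NNReal Classical

namespace Literature.NumberTheory.Automorphic

/-! ### The assembly -/

/-- **Jacquet–Langlands (1970), proof of Thm. 11.1 (pp. 171–173), assembled: the analytic package
`(IR)` for clean `A_G`-invariant cuspidal data of `GL₂(𝔸_F)` from the archimedean test vector `(A∞)`
(Thm. 5.15 (ii)(iii) / Thm. 6.4, as used on p. 173) and the Euler factorisation with functional
equation of the global Hecke integral of pure tensors in the form `(E′)` (archimedean absolute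
convergence as a hypothesis; (11.1.2), p. 172, Lemma 11.1.3).**
See the module docstring for the dictionary; the local finite inputs (test vectors, `L`-factors of the
`L²` local components, unramified Euler factors) are the tree's theorems.
[cite: JacquetLanglands1970, Thm. 5.15, Thm. 6.4, (11.1.2), Lemma 11.1.3, proof of Thm. 11.1 (pp. 171–173)] -/
theorem integralRepresentation_clean_of_archHeckeTestVector_of_heckeEulerFactorisation'
    (hA : ∀ (K : Type) [Field K] [NumberField K] (hcpt : isCompact_glFiniteIntegralLevel 2 K)
      (E : Type) [NormedAddCommGroup E] [InnerProductSpace ℂ E] [CompleteSpace E]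
      (τ : ContRepresentation ℂ (AutomorphyDatum.gl 2 K hcpt).arch.carrier E) (hτ : τ.IsStronglyContinuous)
      (_ : τ.IsUnitary) (_ : τ.IsTopIrreducible)
      (ℓ : archGardingSpace hcpt τ →ₗ[ℂ] ℂ) (_ : IsArchContWhittakerFunctional hcpt τ hτ ℓ) (_ : ℓ ≠ 0)
      [MeasurableSpace ((mixedSpace K)ˣ)] [BorelSpace ((mixedSpace K)ˣ)]
      (μ : Measure ((mixedSpace K)ˣ)) (_ : IsHaarMeasure μ),
      ∃ (e₀ : archGardingSpace hcpt τ)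
        (_ : FiniteDimensional ℂ (Submodule.span ℂ (Set.range
          fun κ : (AutomorphyDatum.gl 2 K hcpt).arch.maximalCompact =>
            τ (toArch hcpt (κ : GL (Fin 2) (mixedSpace K))) (e₀ : E))))
        (d₁ d₂ d₁' d₂' : ℕ) (a : Fin d₁ → ℂ) (b : Fin d₂ → ℂ) (a' : Fin d₁' → ℂ) (b' : Fin d₂' → ℂ)
        (A A' : ℂ) (_ : A ≠ 0) (_ : A' ≠ 0) (α α' : ℂ) (x₀ : ℝ),
        (∀ s : ℂ, x₀ < s.re →
          Integrable (fun u : (mixedSpace K)ˣ =>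
            kirillovFn hτ ℓ e₀ u *
              ((mixedEmbedding.norm ((u : (mixedSpace K)ˣ) : mixedSpace K) : ℝ) : ℂ) ^ (s - 1 / 2)) μ ∧
          ∫ u : (mixedSpace K)ˣ, kirillovFn hτ ℓ e₀ u *
              ((mixedEmbedding.norm ((u : (mixedSpace K)ˣ) : mixedSpace K) : ℝ) : ℂ) ^ (s - 1 / 2) ∂μ =
            A * Complex.exp (α * s) *
              ((∏ j, Complex.Gammaℝ (s + a j)) * ∏ j, Complex.Gammaℂ (s + b j))) ∧
        (∀ s : ℂ, x₀ < s.re →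
          Integrable (fun u : (mixedSpace K)ˣ =>
            tildeFn (fun g : GL (Fin 2) (mixedSpace K) =>
                ℓ ⟨τ (toArch hcpt g) (e₀ : E), apply_mem_archGardingSpace hτ _ e₀.2⟩) (diagGL2 u 1) *
              ((mixedEmbedding.norm ((u : (mixedSpace K)ˣ) : mixedSpace K) : ℝ) : ℂ) ^ (s - 1 / 2)) μ ∧
          ∫ u : (mixedSpace K)ˣ,
              tildeFn (fun g : GL (Fin 2) (mixedSpace K) =>
                  ℓ ⟨τ (toArch hcpt g) (e₀ : E), apply_mem_archGardingSpace hτ _ e₀.2⟩) (diagGL2 u 1) *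
                ((mixedEmbedding.norm ((u : (mixedSpace K)ˣ) : mixedSpace K) : ℝ) : ℂ) ^ (s - 1 / 2) ∂μ =
            A' * Complex.exp (α' * s) *
              ((∏ j, Complex.Gammaℝ (s + a' j)) * ∏ j, Complex.Gammaℂ (s + b' j))))
    (hE : ∀ {K : Type} [Field K] [NumberField K] (hcpt : isCompact_glFiniteIntegralLevel 2 K)
      (μ : Measure (AdelicGroupData.gl 2 K).automorphicQuotient) [(AdelicGroupData.gl 2 K).IsAutomorphicMeasure μ]
      (Pl : CuspidalAutomorphicRepGL 2 K μ)
      [MeasurableSpace ((mixedSpace K)ˣ)] [BorelSpace ((mixedSpace K)ˣ)]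
      [∀ u : HeightOneSpectrum (𝓞 K), MeasurableSpace (u.adicCompletion K)]
      [∀ u : HeightOneSpectrum (𝓞 K), BorelSpace (u.adicCompletion K)]
      [∀ u : HeightOneSpectrum (𝓞 K),
        MeasurableSpace (GL (Fin 1) (u.adicCompletion K) ⧸ upperUnitriangular (Fin 1) (u.adicCompletion K))]
      [∀ u : HeightOneSpectrum (𝓞 K),
        BorelSpace (GL (Fin 1) (u.adicCompletion K) ⧸ upperUnitriangular (Fin 1) (u.adicCompletion K))],
      ∃ (S₀ : Finset (HeightOneSpectrum (𝓞 K))) (αf : SatakeFamily K)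
        (_ : IsSatakeFamilyOf Pl (S₀ : Set (HeightOneSpectrum (𝓞 K))) αf)
        (E : Type) (_ : NormedAddCommGroup E) (_ : InnerProductSpace ℂ E) (_ : CompleteSpace E)
        (τ : ContRepresentation ℂ (AutomorphyDatum.gl 2 K hcpt).arch.carrier E) (hτ : τ.IsStronglyContinuous)
        (_ : τ.IsUnitary) (_ : τ.IsTopIrreducible)
        (ℓ : archGardingSpace hcpt τ →ₗ[ℂ] ℂ) (_ : IsArchContWhittakerFunctional hcpt τ hτ ℓ) (_ : ℓ ≠ 0)
        (μi : Measure ((mixedSpace K)ˣ)) (_ : IsHaarMeasure μi)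
        (Vl : HeightOneSpectrum (𝓞 K) → Type) (_ : ∀ u, AddCommGroup (Vl u)) (_ : ∀ u, Module ℂ (Vl u))
        (ρ : ∀ u : HeightOneSpectrum (𝓞 K), Representation ℂ (GL (Fin 2) (u.adicCompletion K)) (Vl u))
        (_ : ∀ u, (ρ u).IsIrreducible) (_ : ∀ u, (ρ u).IsSmooth)
        (_ : ∀ u, Automorphic.HasLocalComponentAt Pl.1 u (ρ u))
        (Λ : ∀ u, Module.Dual ℂ (Vl u))
        (_ : ∀ u, Λ u ∈ whittakerFunctionals (ρ u) ((adeleAddChar K).adicComponent u)) (_ : ∀ u, Λ u ≠ 0)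
        (ν : ∀ u : HeightOneSpectrum (𝓞 K),
          Measure (GL (Fin 1) (u.adicCompletion K) ⧸ upperUnitriangular (Fin 1) (u.adicCompletion K)))
        (_ : ∀ u, SMulInvariantMeasure (GL (Fin 1) (u.adicCompletion K))
          (GL (Fin 1) (u.adicCompletion K) ⧸ upperUnitriangular (Fin 1) (u.adicCompletion K)) (ν u))
        (_ : ∀ u, IsFiniteMeasureOnCompacts (ν u)) (_ : ∀ u, (ν u).IsOpenPosMeasure),
        ∀ (S : Finset (HeightOneSpectrum (𝓞 K))), S₀ ⊆ S →
        ∀ (t : ∀ u, Vl u) (e₀ : archGardingSpace hcpt τ),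
          FiniteDimensional ℂ (Submodule.span ℂ (Set.range
            fun κ : (AutomorphyDatum.gl 2 K hcpt).arch.maximalCompact =>
              τ (toArch hcpt (κ : GL (Fin 2) (mixedSpace K))) (e₀ : E))) →
        ∀ x₁ : ℝ, (∀ s : ℂ, x₁ < s.re →
            Integrable (fun u : (mixedSpace K)ˣ => kirillovFn hτ ℓ e₀ u *
              ((mixedEmbedding.norm ((u : (mixedSpace K)ˣ) : mixedSpace K) : ℝ) : ℂ) ^ (s - 1 / 2)) μi ∧
            Integrable (fun u : (mixedSpace K)ˣ =>
              tildeFn (fun g : GL (Fin 2) (mixedSpace K) =>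
                  ℓ ⟨τ (toArch hcpt g) (e₀ : E), apply_mem_archGardingSpace hτ _ e₀.2⟩) (diagGL2 u 1) *
                ((mixedEmbedding.norm ((u : (mixedSpace K)ˣ) : mixedSpace K) : ℝ) : ℂ) ^ (s - 1 / 2)) μi) →
          ∃ (Z Z' : ℂ → ℂ) (c : ℝ), Differentiable ℂ Z ∧ Differentiable ℂ Z' ∧ (∀ s, Z s = Z' (1 - s)) ∧
            (∀ s : ℂ, c < s.re → Z s =
              (∫ u : (mixedSpace K)ˣ, kirillovFn hτ ℓ e₀ u *
                  ((mixedEmbedding.norm ((u : (mixedSpace K)ˣ) : mixedSpace K) : ℝ) : ℂ) ^ (s - 1 / 2) ∂μi) *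
                (∏ u ∈ S, rsZeta Nat.one_lt_two (ν u) (whittakerModel (ρ u) (Λ u) (t u)) (fun _ => 1) s) *
                partialStandardL (S : Set (HeightOneSpectrum (𝓞 K))) αf s) ∧
            (∀ s : ℂ, c < s.re → Z' s =
              (∫ u : (mixedSpace K)ˣ,
                  tildeFn (fun g : GL (Fin 2) (mixedSpace K) =>
                      ℓ ⟨τ (toArch hcpt g) (e₀ : E), apply_mem_archGardingSpace hτ _ e₀.2⟩) (diagGL2 u 1) *
                    ((mixedEmbedding.norm ((u : (mixedSpace K)ˣ) : mixedSpace K) : ℝ) : ℂ) ^ (s - 1 / 2) ∂μi) *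
                (∏ u ∈ S, rsZeta Nat.one_lt_two (ν u) (tildeFn (whittakerModel (ρ u) (Λ u) (t u)))
                  (fun _ => 1) s) *
                partialStandardL (S : Set (HeightOneSpectrum (𝓞 K))) (dualFamily αf) s))
    {F : Type} [Field F] [NumberField F] (hcpt : isCompact_glFiniteIntegralLevel 2 F)
    (π : CuspidalAutomorphicRepData 2 F hcpt) (P P' : HeightOneSpectrum (𝓞 F) → ℂ[X])
    (hbot : π.1.W' = ⊥)
    (hAG : ∀ φ ∈ π.1.W, ∀ (t : ℝ≥0ˣ) (g : (AdelicGroupData.gl 2 F).Adelic),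
      φ ((show (AdelicGroupData.gl 2 F).Adelic from posRealScalar 2 F t) * g) = φ g)
    (hP : ∀ (u : HeightOneSpectrum (𝓞 F)) (πu : SmoothIrrep (GL (Fin 2) (u.adicCompletion F))),
      π.1.HasLocalComponentAt u πu.ρ →
      ∀ (ψ : AddChar (u.adicCompletion F) Circle), ψ.IsContinuousNontrivial →
      ∀ [MeasurableSpace (u.adicCompletion F)] [BorelSpace (u.adicCompletion F)]
        [MeasurableSpace (GL (Fin 1) (u.adicCompletion F) ⧸ upperUnitriangular (Fin 1) (u.adicCompletion F))]
        [BorelSpace (GL (Fin 1) (u.adicCompletion F) ⧸ upperUnitriangular (Fin 1) (u.adicCompletion F))]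
        (ν : Measure (GL (Fin 1) (u.adicCompletion F) ⧸ upperUnitriangular (Fin 1) (u.adicCompletion F)))
        [SMulInvariantMeasure (GL (Fin 1) (u.adicCompletion F))
          (GL (Fin 1) (u.adicCompletion F) ⧸ upperUnitriangular (Fin 1) (u.adicCompletion F)) ν]
        [IsFiniteMeasureOnCompacts ν] [ν.IsOpenPosMeasure],
        HasRSLFactor Nat.one_lt_two πu.ρ
          (Representation.trivial ℂ (GL (Fin 1) (u.adicCompletion F)) ℂ) ψ ν (P u))
    (hP' : ∀ (u : HeightOneSpectrum (𝓞 F)) (πu : SmoothIrrep (GL (Fin 2) (u.adicCompletion F))),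
      π.transposeInv.1.HasLocalComponentAt u πu.ρ →
      ∀ (ψ : AddChar (u.adicCompletion F) Circle), ψ.IsContinuousNontrivial →
      ∀ [MeasurableSpace (u.adicCompletion F)] [BorelSpace (u.adicCompletion F)]
        [MeasurableSpace (GL (Fin 1) (u.adicCompletion F) ⧸ upperUnitriangular (Fin 1) (u.adicCompletion F))]
        [BorelSpace (GL (Fin 1) (u.adicCompletion F) ⧸ upperUnitriangular (Fin 1) (u.adicCompletion F))]
        (ν : Measure (GL (Fin 1) (u.adicCompletion F) ⧸ upperUnitriangular (Fin 1) (u.adicCompletion F)))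
        [SMulInvariantMeasure (GL (Fin 1) (u.adicCompletion F))
          (GL (Fin 1) (u.adicCompletion F) ⧸ upperUnitriangular (Fin 1) (u.adicCompletion F)) ν]
        [IsFiniteMeasureOnCompacts ν] [ν.IsOpenPosMeasure],
        HasRSLFactor Nat.one_lt_two πu.ρ
          (Representation.trivial ℂ (GL (Fin 1) (u.adicCompletion F)) ℂ) ψ ν (P' u)) :
    ∃ (c₀ : ℝ) (Z Z' J J' Γ Γ' η : ℂ → ℂ),
      Differentiable ℂ Z ∧ Differentiable ℂ Z' ∧ Differentiable ℂ J ∧ Differentiable ℂ J' ∧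
      Differentiable ℂ Γ ∧ Differentiable ℂ Γ' ∧
      (∃ Y : Set ℝ, Y.Finite ∧ ∀ s, Γ s = 0 → s.im ∈ Y) ∧
      (∃ Y : Set ℝ, Y.Finite ∧ ∀ s, Γ' s = 0 → s.im ∈ Y) ∧
      (∀ s : ℂ, c₀ < s.re → J s ≠ 0 ∧ Z s * Γ s =
        J s * ∏' u : HeightOneSpectrum (𝓞 F), ((P u).eval ((u.residueCard : ℂ) ^ (-s)))⁻¹) ∧
      (∀ s : ℂ, c₀ < s.re → J' s ≠ 0 ∧ Z' s * Γ' s =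
        J' s * ∏' u : HeightOneSpectrum (𝓞 F), ((P' u).eval ((u.residueCard : ℂ) ^ (-s)))⁻¹) ∧
      (∀ s, Z s = Z' (1 - s)) ∧
      Continuous η ∧ (∀ s, η s ≠ 0) ∧ (∀ s, J' (1 - s) = η s * J s) := by
  classical
  /- `L²` realisations of `π` and of `π^τ` -/
  obtain ⟨μ, hμ⟩ : AdelicGroupData.exists_isAutomorphicMeasure_gl 2 F :=
    AdelicGroupData.exists_isAutomorphicMeasure_gl_holds 2 F
  haveI := hμ
  have hAG' : ∀ φ ∈ π.1.W, ∀ z ∈ (AdelicGroupData.gl 2 F).center', ∀ g, φ (z * g) = φ g := by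
    intro φ hφ z hz g
    obtain ⟨t, rfl⟩ := MonoidHom.mem_range.1 hz
    exact hAG φ hφ t g
  obtain ⟨Pl, hass⟩ := AutomorphicRepsGL.exists_isAssociatedL2_holds hcpt μ π hAG'
  obtain ⟨Pd, hassd⟩ := π.exists_isAssociatedL2_transposeInv μ hAG
  /- Borel structures at every place -/
  letI mA : MeasurableSpace ((mixedSpace F)ˣ) := borel _
  haveI : BorelSpace ((mixedSpace F)ˣ) := ⟨rfl⟩
  letI mF : ∀ u : HeightOneSpectrum (𝓞 F), MeasurableSpace (u.adicCompletion F) := fun u => borel _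
  haveI : ∀ u : HeightOneSpectrum (𝓞 F), BorelSpace (u.adicCompletion F) := fun u => ⟨rfl⟩
  letI mQ : ∀ u : HeightOneSpectrum (𝓞 F),
      MeasurableSpace (GL (Fin 1) (u.adicCompletion F) ⧸ upperUnitriangular (Fin 1) (u.adicCompletion F)) :=
    fun u => borel _
  haveI : ∀ u : HeightOneSpectrum (𝓞 F),
      BorelSpace (GL (Fin 1) (u.adicCompletion F) ⧸ upperUnitriangular (Fin 1) (u.adicCompletion F)) :=
    fun u => ⟨rfl⟩
  /- the Euler factorisation data of `Π` -/
  obtain ⟨S₀, αf, hαf, E, _, _, _, τ, hτ, hτu, hτi, ℓ, hℓ, hℓ0, μi, hμi, Vl, _, _, ρ, hρi, hρs, hρL, Λ, hΛ,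
    hΛ0, ν, hν₁, hν₂, hν₃, hEul⟩ := hE hcpt μ Pl
  /- the archimedean test vector -/
  obtain ⟨e₀, he₀, d₁, d₂, d₁', d₂', a, b, a', b', A, A', hA0, hA'0, αe, αe', x₀, hI, hI'⟩ :=
    hA F hcpt E τ hτ hτu hτi ℓ hℓ hℓ0 μi hμi
  /- local test vectors at the finite places -/
  have hψ : ∀ u : HeightOneSpectrum (𝓞 F), ((adeleAddChar F).adicComponent u).IsContinuousNontrivial :=
    fun u => (isGlobalAddChar_adeleAddChar F).isContinuousNontrivial_adicComponent
      (adicComponent_adeleAddChar_ne_one u)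
  have hloc : ∀ u : HeightOneSpectrum (𝓞 F), ∃ (tu : Vl u) (eu : ℂ) (ku : ℤ) (xu : ℝ), eu ≠ 0 ∧
      (∀ s : ℂ, xu < s.re →
        rsZeta Nat.one_lt_two (ν u) (whittakerModel (ρ u) (Λ u) tu) (fun _ => 1) s =
          ((P u).eval ((u.residueCard : ℂ) ^ (-s)))⁻¹) ∧
      (∀ s : ℂ, xu < s.re →
        rsZeta Nat.one_lt_two (ν u) (tildeFn (whittakerModel (ρ u) (Λ u) tu)) (fun _ => 1) s =
          eu * ((u.residueCard : ℂ) ^ (-s)) ^ ku * ((P' u).eval ((u.residueCard : ℂ) ^ (-s)))⁻¹) := by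
    intro u
    haveI := hρi u
    haveI := hν₁ u
    haveI := hν₂ u
    haveI := hν₃ u
    have h₁ := hasRSLFactor_of_isAssociatedL2_of_hasLocalComponentAt hbot hass hP u (hρi u) (hρs u)
      (hρL u) _ (hψ u) (ν u)
    have h₂ := hasRSLFactor_comp_glTransposeInv_of_isAssociatedL2_of_hasLocalComponentAt hbot hass hP' u
      (hρi u) (hρs u) (hρL u) _ (hψ u).inv (ν u)
    obtain ⟨tu, eu, ku, xu, heu, h₃, h₄⟩ :=
      exists_testVector_rsZeta_and_tildeFn (ρ u) (hρs u) (hψ u) (hΛ u) (hΛ0 u) (ν u) h₁ h₂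
    refine ⟨tu, eu, ku, xu, heu, fun s hs => ?_, fun s hs => ?_⟩
    · rw [h₃ s hs, residueFieldCard_adicCompletion_eq]
    · rw [h₄ s hs, residueFieldCard_adicCompletion_eq]
  choose t e k x he hZu hZ'u using hloc
  /- the global Hecke integrals of the pure tensor with these local components -/
  obtain ⟨Z, Z', c, hZd, hZ'd, hFE, hZE, hZ'E⟩ := hEul S₀ (Finset.Subset.refl _) t e₀ he₀ x₀
    (fun s hs => ⟨(hI s hs).1, (hI' s hs).1⟩)
  /- the finite-place `ε`-monomials -/
  obtain ⟨hEsd, hEs0⟩ := differentiable_prod_epsilonMonomial S₀ e k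
  /- the abscissa -/
  set c₁ : ℝ := max (max c x₀) (max 1 (∑ u ∈ S₀, |x u|)) with hc₁
  have hc_lt : ∀ {s : ℂ}, c₁ < s.re → c < s.re := fun hs =>
    lt_of_le_of_lt ((le_max_left _ _).trans (le_max_left _ _)) hs
  have hx₀_lt : ∀ {s : ℂ}, c₁ < s.re → x₀ < s.re := fun hs =>
    lt_of_le_of_lt ((le_max_right _ _).trans (le_max_left _ _)) hs
  have h1_lt : ∀ {s : ℂ}, c₁ < s.re → 1 < s.re := fun hs =>
    lt_of_le_of_lt ((le_max_left _ _).trans (le_max_right _ _)) hs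
  have hxu_lt : ∀ {s : ℂ}, c₁ < s.re → ∀ u ∈ S₀, x u < s.re := fun hs u hu =>
    lt_of_le_of_lt (((le_abs_self _).trans
      (Finset.single_le_sum (fun v _ => abs_nonneg (x v)) hu)).trans
        ((le_max_right _ _).trans (le_max_right _ _))) hs
  /- the `π`-side on the half-plane `re s > c₁` -/
  have hZ₁ : ∀ s : ℂ, c₁ < s.re →
      Z s = A * Complex.exp (αe * s) * ((∏ j, Complex.Gammaℝ (s + a j)) * ∏ j, Complex.Gammaℂ (s + b j)) *
        ∏' u : HeightOneSpectrum (𝓞 F), ((P u).eval ((u.residueCard : ℂ) ^ (-s)))⁻¹ := by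
    intro s hs
    rw [hZE s (hc_lt hs), (hI s (hx₀_lt hs)).2,
      tprod_localEulerPolynomial_eq_prod_mul_partialStandardL hass S₀ hαf hP s
        (multipliable_partialStandardL_holds Pl hαf (h1_lt hs)),
      Finset.prod_congr rfl fun u hu => hZu u s (hxu_lt hs u hu)]
    ring
  /- the `π^τ`-side on the half-plane `re s > c₁` -/
  have hZ'₁ : ∀ s : ℂ, c₁ < s.re →
      Z' s = A' * Complex.exp (αe' * s) * (∏ u ∈ S₀, e u * ((u.residueCard : ℂ) ^ (-s)) ^ (k u)) *
        ((∏ j, Complex.Gammaℝ (s + a' j)) * ∏ j, Complex.Gammaℂ (s + b' j)) *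
        ∏' u : HeightOneSpectrum (𝓞 F), ((P' u).eval ((u.residueCard : ℂ) ^ (-s)))⁻¹ := by
    intro s hs
    rw [hZ'E s (hc_lt hs), (hI' s (hx₀_lt hs)).2,
      tprod_localEulerPolynomial_transposeInv_eq_prod_mul_partialStandardL_dualFamily hass S₀ hαf hP' s
        (multipliable_partialEuler_dualFamily hass hassd hαf (h1_lt hs)),
      Finset.prod_congr rfl fun u hu => hZ'u u s (hxu_lt hs u hu), Finset.prod_mul_distrib]
    ring
  /- the Gamma bookkeeping -/
  obtain ⟨c₀, J, J', Γ, Γ', η, hJ, hJ', hΓ, hΓ', hY, hY', hZΓ, hZ'Γ, hη, hη0, hηJ⟩ :=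
    integralRepresentation_of_eulerFactorisations
      (L := fun s => ∏' u : HeightOneSpectrum (𝓞 F), ((P u).eval ((u.residueCard : ℂ) ^ (-s)))⁻¹)
      (L' := fun s => ∏' u : HeightOneSpectrum (𝓞 F), ((P' u).eval ((u.residueCard : ℂ) ^ (-s)))⁻¹)
      a b a' b' hA0 hA'0 hEsd (hEs0 he) hZ₁ hZ'₁
  exact ⟨c₀, Z, Z', J, J', Γ, Γ', η, hZd, hZ'd, hJ, hJ', hΓ, hΓ', hY, hY', hZΓ, hZ'Γ, hFE, hη, hη0, hηJ⟩

/-- **Jacquet–Langlands (1970), Thm. 11.1, from `(A∞)` and `(E′)`**: the named fact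
`JacquetLanglands1970_standardLTheoryGL2` follows from the archimedean test vector and the Euler
factorisation of the global Hecke integral (`JacquetLanglands1970_standardLTheoryGL2_of_integralRepresentation_clean`).
[cite: JacquetLanglands1970, Thm. 11.1 (proof, pp. 171–173)] -/
theorem JacquetLanglands1970_standardLTheoryGL2_of_archHeckeTestVector_of_heckeEulerFactorisation'
    (hA : ∀ (K : Type) [Field K] [NumberField K] (hcpt : isCompact_glFiniteIntegralLevel 2 K)
      (E : Type) [NormedAddCommGroup E] [InnerProductSpace ℂ E] [CompleteSpace E]
      (τ : ContRepresentation ℂ (AutomorphyDatum.gl 2 K hcpt).arch.carrier E) (hτ : τ.IsStronglyContinuous)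
      (_ : τ.IsUnitary) (_ : τ.IsTopIrreducible)
      (ℓ : archGardingSpace hcpt τ →ₗ[ℂ] ℂ) (_ : IsArchContWhittakerFunctional hcpt τ hτ ℓ) (_ : ℓ ≠ 0)
      [MeasurableSpace ((mixedSpace K)ˣ)] [BorelSpace ((mixedSpace K)ˣ)]
      (μ : Measure ((mixedSpace K)ˣ)) (_ : IsHaarMeasure μ),
      ∃ (e₀ : archGardingSpace hcpt τ)
        (_ : FiniteDimensional ℂ (Submodule.span ℂ (Set.range
          fun κ : (AutomorphyDatum.gl 2 K hcpt).arch.maximalCompact =>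
            τ (toArch hcpt (κ : GL (Fin 2) (mixedSpace K))) (e₀ : E))))
        (d₁ d₂ d₁' d₂' : ℕ) (a : Fin d₁ → ℂ) (b : Fin d₂ → ℂ) (a' : Fin d₁' → ℂ) (b' : Fin d₂' → ℂ)
        (A A' : ℂ) (_ : A ≠ 0) (_ : A' ≠ 0) (α α' : ℂ) (x₀ : ℝ),
        (∀ s : ℂ, x₀ < s.re →
          Integrable (fun u : (mixedSpace K)ˣ =>
            kirillovFn hτ ℓ e₀ u *
              ((mixedEmbedding.norm ((u : (mixedSpace K)ˣ) : mixedSpace K) : ℝ) : ℂ) ^ (s - 1 / 2)) μ ∧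
          ∫ u : (mixedSpace K)ˣ, kirillovFn hτ ℓ e₀ u *
              ((mixedEmbedding.norm ((u : (mixedSpace K)ˣ) : mixedSpace K) : ℝ) : ℂ) ^ (s - 1 / 2) ∂μ =
            A * Complex.exp (α * s) *
              ((∏ j, Complex.Gammaℝ (s + a j)) * ∏ j, Complex.Gammaℂ (s + b j))) ∧
        (∀ s : ℂ, x₀ < s.re →
          Integrable (fun u : (mixedSpace K)ˣ =>
            tildeFn (fun g : GL (Fin 2) (mixedSpace K) =>
                ℓ ⟨τ (toArch hcpt g) (e₀ : E), apply_mem_archGardingSpace hτ _ e₀.2⟩) (diagGL2 u 1) *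
              ((mixedEmbedding.norm ((u : (mixedSpace K)ˣ) : mixedSpace K) : ℝ) : ℂ) ^ (s - 1 / 2)) μ ∧
          ∫ u : (mixedSpace K)ˣ,
              tildeFn (fun g : GL (Fin 2) (mixedSpace K) =>
                  ℓ ⟨τ (toArch hcpt g) (e₀ : E), apply_mem_archGardingSpace hτ _ e₀.2⟩) (diagGL2 u 1) *
                ((mixedEmbedding.norm ((u : (mixedSpace K)ˣ) : mixedSpace K) : ℝ) : ℂ) ^ (s - 1 / 2) ∂μ =
            A' * Complex.exp (α' * s) *
              ((∏ j, Complex.Gammaℝ (s + a' j)) * ∏ j, Complex.Gammaℂ (s + b' j))))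
    (hE : ∀ {K : Type} [Field K] [NumberField K] (hcpt : isCompact_glFiniteIntegralLevel 2 K)
      (μ : Measure (AdelicGroupData.gl 2 K).automorphicQuotient) [(AdelicGroupData.gl 2 K).IsAutomorphicMeasure μ]
      (Pl : CuspidalAutomorphicRepGL 2 K μ)
      [MeasurableSpace ((mixedSpace K)ˣ)] [BorelSpace ((mixedSpace K)ˣ)]
      [∀ u : HeightOneSpectrum (𝓞 K), MeasurableSpace (u.adicCompletion K)]
      [∀ u : HeightOneSpectrum (𝓞 K), BorelSpace (u.adicCompletion K)]
      [∀ u : HeightOneSpectrum (𝓞 K),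
        MeasurableSpace (GL (Fin 1) (u.adicCompletion K) ⧸ upperUnitriangular (Fin 1) (u.adicCompletion K))]
      [∀ u : HeightOneSpectrum (𝓞 K),
        BorelSpace (GL (Fin 1) (u.adicCompletion K) ⧸ upperUnitriangular (Fin 1) (u.adicCompletion K))],
      ∃ (S₀ : Finset (HeightOneSpectrum (𝓞 K))) (αf : SatakeFamily K)
        (_ : IsSatakeFamilyOf Pl (S₀ : Set (HeightOneSpectrum (𝓞 K))) αf)
        (E : Type) (_ : NormedAddCommGroup E) (_ : InnerProductSpace ℂ E) (_ : CompleteSpace E)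
        (τ : ContRepresentation ℂ (AutomorphyDatum.gl 2 K hcpt).arch.carrier E) (hτ : τ.IsStronglyContinuous)
        (_ : τ.IsUnitary) (_ : τ.IsTopIrreducible)
        (ℓ : archGardingSpace hcpt τ →ₗ[ℂ] ℂ) (_ : IsArchContWhittakerFunctional hcpt τ hτ ℓ) (_ : ℓ ≠ 0)
        (μi : Measure ((mixedSpace K)ˣ)) (_ : IsHaarMeasure μi)
        (Vl : HeightOneSpectrum (𝓞 K) → Type) (_ : ∀ u, AddCommGroup (Vl u)) (_ : ∀ u, Module ℂ (Vl u))
        (ρ : ∀ u : HeightOneSpectrum (𝓞 K), Representation ℂ (GL (Fin 2) (u.adicCompletion K)) (Vl u))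
        (_ : ∀ u, (ρ u).IsIrreducible) (_ : ∀ u, (ρ u).IsSmooth)
        (_ : ∀ u, Automorphic.HasLocalComponentAt Pl.1 u (ρ u))
        (Λ : ∀ u, Module.Dual ℂ (Vl u))
        (_ : ∀ u, Λ u ∈ whittakerFunctionals (ρ u) ((adeleAddChar K).adicComponent u)) (_ : ∀ u, Λ u ≠ 0)
        (ν : ∀ u : HeightOneSpectrum (𝓞 K),
          Measure (GL (Fin 1) (u.adicCompletion K) ⧸ upperUnitriangular (Fin 1) (u.adicCompletion K)))
        (_ : ∀ u, SMulInvariantMeasure (GL (Fin 1) (u.adicCompletion K))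
          (GL (Fin 1) (u.adicCompletion K) ⧸ upperUnitriangular (Fin 1) (u.adicCompletion K)) (ν u))
        (_ : ∀ u, IsFiniteMeasureOnCompacts (ν u)) (_ : ∀ u, (ν u).IsOpenPosMeasure),
        ∀ (S : Finset (HeightOneSpectrum (𝓞 K))), S₀ ⊆ S →
        ∀ (t : ∀ u, Vl u) (e₀ : archGardingSpace hcpt τ),
          FiniteDimensional ℂ (Submodule.span ℂ (Set.range
            fun κ : (AutomorphyDatum.gl 2 K hcpt).arch.maximalCompact =>
              τ (toArch hcpt (κ : GL (Fin 2) (mixedSpace K))) (e₀ : E))) →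
        ∀ x₁ : ℝ, (∀ s : ℂ, x₁ < s.re →
            Integrable (fun u : (mixedSpace K)ˣ => kirillovFn hτ ℓ e₀ u *
              ((mixedEmbedding.norm ((u : (mixedSpace K)ˣ) : mixedSpace K) : ℝ) : ℂ) ^ (s - 1 / 2)) μi ∧
            Integrable (fun u : (mixedSpace K)ˣ =>
              tildeFn (fun g : GL (Fin 2) (mixedSpace K) =>
                  ℓ ⟨τ (toArch hcpt g) (e₀ : E), apply_mem_archGardingSpace hτ _ e₀.2⟩) (diagGL2 u 1) *
                ((mixedEmbedding.norm ((u : (mixedSpace K)ˣ) : mixedSpace K) : ℝ) : ℂ) ^ (s - 1 / 2)) μi) →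
          ∃ (Z Z' : ℂ → ℂ) (c : ℝ), Differentiable ℂ Z ∧ Differentiable ℂ Z' ∧ (∀ s, Z s = Z' (1 - s)) ∧
            (∀ s : ℂ, c < s.re → Z s =
              (∫ u : (mixedSpace K)ˣ, kirillovFn hτ ℓ e₀ u *
                  ((mixedEmbedding.norm ((u : (mixedSpace K)ˣ) : mixedSpace K) : ℝ) : ℂ) ^ (s - 1 / 2) ∂μi) *
                (∏ u ∈ S, rsZeta Nat.one_lt_two (ν u) (whittakerModel (ρ u) (Λ u) (t u)) (fun _ => 1) s) *
                partialStandardL (S : Set (HeightOneSpectrum (𝓞 K))) αf s) ∧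
            (∀ s : ℂ, c < s.re → Z' s =
              (∫ u : (mixedSpace K)ˣ,
                  tildeFn (fun g : GL (Fin 2) (mixedSpace K) =>
                      ℓ ⟨τ (toArch hcpt g) (e₀ : E), apply_mem_archGardingSpace hτ _ e₀.2⟩) (diagGL2 u 1) *
                    ((mixedEmbedding.norm ((u : (mixedSpace K)ˣ) : mixedSpace K) : ℝ) : ℂ) ^ (s - 1 / 2) ∂μi) *
                (∏ u ∈ S, rsZeta Nat.one_lt_two (ν u) (tildeFn (whittakerModel (ρ u) (Λ u) (t u)))
                  (fun _ => 1) s) *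
                partialStandardL (S : Set (HeightOneSpectrum (𝓞 K))) (dualFamily αf) s)) :
    JacquetLanglands1970_standardLTheoryGL2 :=
  JacquetLanglands1970_standardLTheoryGL2_of_integralRepresentation_clean
    fun hcpt π P P' hbot hAG hP hP' =>
      integralRepresentation_clean_of_archHeckeTestVector_of_heckeEulerFactorisation' hA hE hcpt π P P'
        hbot hAG hP hP'

/-- **The dependants follow**: Frobenius–Satake compatibility at the `σ`-unramified places
(`frobSatakeCompatibleAt_of_isPiOfArtinRep_of_isUnramifiedAt`) from `(A∞)` and `(E′)`.
[cite: JacquetLanglands1970, Thm. 11.1 (proof, pp. 171–173)] [cite: Gelbart1997, Lecture II] -/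
theorem frobSatakeCompatibleAt_of_isPiOfArtinRep_of_isUnramifiedAt_of_archHeckeTestVector_of_heckeEulerFactorisation'
    (hA : ∀ (K : Type) [Field K] [NumberField K] (hcpt : isCompact_glFiniteIntegralLevel 2 K)
      (E : Type) [NormedAddCommGroup E] [InnerProductSpace ℂ E] [CompleteSpace E]
      (τ : ContRepresentation ℂ (AutomorphyDatum.gl 2 K hcpt).arch.carrier E) (hτ : τ.IsStronglyContinuous)
      (_ : τ.IsUnitary) (_ : τ.IsTopIrreducible)
      (ℓ : archGardingSpace hcpt τ →ₗ[ℂ] ℂ) (_ : IsArchContWhittakerFunctional hcpt τ hτ ℓ) (_ : ℓ ≠ 0)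
      [MeasurableSpace ((mixedSpace K)ˣ)] [BorelSpace ((mixedSpace K)ˣ)]
      (μ : Measure ((mixedSpace K)ˣ)) (_ : IsHaarMeasure μ),
      ∃ (e₀ : archGardingSpace hcpt τ)
        (_ : FiniteDimensional ℂ (Submodule.span ℂ (Set.range
          fun κ : (AutomorphyDatum.gl 2 K hcpt).arch.maximalCompact =>
            τ (toArch hcpt (κ : GL (Fin 2) (mixedSpace K))) (e₀ : E))))
        (d₁ d₂ d₁' d₂' : ℕ) (a : Fin d₁ → ℂ) (b : Fin d₂ → ℂ) (a' : Fin d₁' → ℂ) (b' : Fin d₂' → ℂ)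
        (A A' : ℂ) (_ : A ≠ 0) (_ : A' ≠ 0) (α α' : ℂ) (x₀ : ℝ),
        (∀ s : ℂ, x₀ < s.re →
          Integrable (fun u : (mixedSpace K)ˣ =>
            kirillovFn hτ ℓ e₀ u *
              ((mixedEmbedding.norm ((u : (mixedSpace K)ˣ) : mixedSpace K) : ℝ) : ℂ) ^ (s - 1 / 2)) μ ∧
          ∫ u : (mixedSpace K)ˣ, kirillovFn hτ ℓ e₀ u *
              ((mixedEmbedding.norm ((u : (mixedSpace K)ˣ) : mixedSpace K) : ℝ) : ℂ) ^ (s - 1 / 2) ∂μ =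
            A * Complex.exp (α * s) *
              ((∏ j, Complex.Gammaℝ (s + a j)) * ∏ j, Complex.Gammaℂ (s + b j))) ∧
        (∀ s : ℂ, x₀ < s.re →
          Integrable (fun u : (mixedSpace K)ˣ =>
            tildeFn (fun g : GL (Fin 2) (mixedSpace K) =>
                ℓ ⟨τ (toArch hcpt g) (e₀ : E), apply_mem_archGardingSpace hτ _ e₀.2⟩) (diagGL2 u 1) *
              ((mixedEmbedding.norm ((u : (mixedSpace K)ˣ) : mixedSpace K) : ℝ) : ℂ) ^ (s - 1 / 2)) μ ∧
          ∫ u : (mixedSpace K)ˣ,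
              tildeFn (fun g : GL (Fin 2) (mixedSpace K) =>
                  ℓ ⟨τ (toArch hcpt g) (e₀ : E), apply_mem_archGardingSpace hτ _ e₀.2⟩) (diagGL2 u 1) *
                ((mixedEmbedding.norm ((u : (mixedSpace K)ˣ) : mixedSpace K) : ℝ) : ℂ) ^ (s - 1 / 2) ∂μ =
            A' * Complex.exp (α' * s) *
              ((∏ j, Complex.Gammaℝ (s + a' j)) * ∏ j, Complex.Gammaℂ (s + b' j))))
    (hE : ∀ {K : Type} [Field K] [NumberField K] (hcpt : isCompact_glFiniteIntegralLevel 2 K)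
      (μ : Measure (AdelicGroupData.gl 2 K).automorphicQuotient) [(AdelicGroupData.gl 2 K).IsAutomorphicMeasure μ]
      (Pl : CuspidalAutomorphicRepGL 2 K μ)
      [MeasurableSpace ((mixedSpace K)ˣ)] [BorelSpace ((mixedSpace K)ˣ)]
      [∀ u : HeightOneSpectrum (𝓞 K), MeasurableSpace (u.adicCompletion K)]
      [∀ u : HeightOneSpectrum (𝓞 K), BorelSpace (u.adicCompletion K)]
      [∀ u : HeightOneSpectrum (𝓞 K),
        MeasurableSpace (GL (Fin 1) (u.adicCompletion K) ⧸ upperUnitriangular (Fin 1) (u.adicCompletion K))]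
      [∀ u : HeightOneSpectrum (𝓞 K),
        BorelSpace (GL (Fin 1) (u.adicCompletion K) ⧸ upperUnitriangular (Fin 1) (u.adicCompletion K))],
      ∃ (S₀ : Finset (HeightOneSpectrum (𝓞 K))) (αf : SatakeFamily K)
        (_ : IsSatakeFamilyOf Pl (S₀ : Set (HeightOneSpectrum (𝓞 K))) αf)
        (E : Type) (_ : NormedAddCommGroup E) (_ : InnerProductSpace ℂ E) (_ : CompleteSpace E)
        (τ : ContRepresentation ℂ (AutomorphyDatum.gl 2 K hcpt).arch.carrier E) (hτ : τ.IsStronglyContinuous)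
        (_ : τ.IsUnitary) (_ : τ.IsTopIrreducible)
        (ℓ : archGardingSpace hcpt τ →ₗ[ℂ] ℂ) (_ : IsArchContWhittakerFunctional hcpt τ hτ ℓ) (_ : ℓ ≠ 0)
        (μi : Measure ((mixedSpace K)ˣ)) (_ : IsHaarMeasure μi)
        (Vl : HeightOneSpectrum (𝓞 K) → Type) (_ : ∀ u, AddCommGroup (Vl u)) (_ : ∀ u, Module ℂ (Vl u))
        (ρ : ∀ u : HeightOneSpectrum (𝓞 K), Representation ℂ (GL (Fin 2) (u.adicCompletion K)) (Vl u))
        (_ : ∀ u, (ρ u).IsIrreducible) (_ : ∀ u, (ρ u).IsSmooth)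
        (_ : ∀ u, Automorphic.HasLocalComponentAt Pl.1 u (ρ u))
        (Λ : ∀ u, Module.Dual ℂ (Vl u))
        (_ : ∀ u, Λ u ∈ whittakerFunctionals (ρ u) ((adeleAddChar K).adicComponent u)) (_ : ∀ u, Λ u ≠ 0)
        (ν : ∀ u : HeightOneSpectrum (𝓞 K),
          Measure (GL (Fin 1) (u.adicCompletion K) ⧸ upperUnitriangular (Fin 1) (u.adicCompletion K)))
        (_ : ∀ u, SMulInvariantMeasure (GL (Fin 1) (u.adicCompletion K))
          (GL (Fin 1) (u.adicCompletion K) ⧸ upperUnitriangular (Fin 1) (u.adicCompletion K)) (ν u))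
        (_ : ∀ u, IsFiniteMeasureOnCompacts (ν u)) (_ : ∀ u, (ν u).IsOpenPosMeasure),
        ∀ (S : Finset (HeightOneSpectrum (𝓞 K))), S₀ ⊆ S →
        ∀ (t : ∀ u, Vl u) (e₀ : archGardingSpace hcpt τ),
          FiniteDimensional ℂ (Submodule.span ℂ (Set.range
            fun κ : (AutomorphyDatum.gl 2 K hcpt).arch.maximalCompact =>
              τ (toArch hcpt (κ : GL (Fin 2) (mixedSpace K))) (e₀ : E))) →
        ∀ x₁ : ℝ, (∀ s : ℂ, x₁ < s.re →
            Integrable (fun u : (mixedSpace K)ˣ => kirillovFn hτ ℓ e₀ u *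
              ((mixedEmbedding.norm ((u : (mixedSpace K)ˣ) : mixedSpace K) : ℝ) : ℂ) ^ (s - 1 / 2)) μi ∧
            Integrable (fun u : (mixedSpace K)ˣ =>
              tildeFn (fun g : GL (Fin 2) (mixedSpace K) =>
                  ℓ ⟨τ (toArch hcpt g) (e₀ : E), apply_mem_archGardingSpace hτ _ e₀.2⟩) (diagGL2 u 1) *
                ((mixedEmbedding.norm ((u : (mixedSpace K)ˣ) : mixedSpace K) : ℝ) : ℂ) ^ (s - 1 / 2)) μi) →
          ∃ (Z Z' : ℂ → ℂ) (c : ℝ), Differentiable ℂ Z ∧ Differentiable ℂ Z' ∧ (∀ s, Z s = Z' (1 - s)) ∧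
            (∀ s : ℂ, c < s.re → Z s =
              (∫ u : (mixedSpace K)ˣ, kirillovFn hτ ℓ e₀ u *
                  ((mixedEmbedding.norm ((u : (mixedSpace K)ˣ) : mixedSpace K) : ℝ) : ℂ) ^ (s - 1 / 2) ∂μi) *
                (∏ u ∈ S, rsZeta Nat.one_lt_two (ν u) (whittakerModel (ρ u) (Λ u) (t u)) (fun _ => 1) s) *
                partialStandardL (S : Set (HeightOneSpectrum (𝓞 K))) αf s) ∧
            (∀ s : ℂ, c < s.re → Z' s =
              (∫ u : (mixedSpace K)ˣ,
                  tildeFn (fun g : GL (Fin 2) (mixedSpace K) =>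
                      ℓ ⟨τ (toArch hcpt g) (e₀ : E), apply_mem_archGardingSpace hτ _ e₀.2⟩) (diagGL2 u 1) *
                    ((mixedEmbedding.norm ((u : (mixedSpace K)ˣ) : mixedSpace K) : ℝ) : ℂ) ^ (s - 1 / 2) ∂μi) *
                (∏ u ∈ S, rsZeta Nat.one_lt_two (ν u) (tildeFn (whittakerModel (ρ u) (Λ u) (t u)))
                  (fun _ => 1) s) *
                partialStandardL (S : Set (HeightOneSpectrum (𝓞 K))) (dualFamily αf) s)) :
    frobSatakeCompatibleAt_of_isPiOfArtinRep_of_isUnramifiedAt :=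
  frobSatakeCompatibleAt_of_isPiOfArtinRep_of_isUnramifiedAt_of_JacquetLanglands1970_standardLTheoryGL2
    (JacquetLanglands1970_standardLTheoryGL2_of_archHeckeTestVector_of_heckeEulerFactorisation' hA hE)

end Literature.NumberTheory.Automorphic

end
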